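import Mathlib
import HarnessLib
import Summits.HubbardSuperconductivity.HubbardSuperconductivity.Theorems.KLProgrammeKLRegimeSplitSlotsV17F2
import Summits.HubbardSuperconductivity.HubbardSuperconductivity.Theorems.KLProgrammeKLRegimeEngineV8DefsU6
import Summits.HubbardSuperconductivity.HubbardSuperconductivity.Theorems.KLProgrammeKLRegimeEngineScaleZeroIsoTupleG5

/-!
# The scale-`0` rung of the K3 ENGINE-FLOW child (`KLRegimeEngineV17F` / rev-2 `…V17F2`, stub (a) `stub_engine_scale0`) in the FLOW
# currency, modulo (E4)₀ by name

Cell `gate-hubbard-kl`, seat hubbard-kl-k3c2-p1 g4 (row «scale-0 Gram step `stub_engine_scale0`»).  The engine-flow template of record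
(plan g16, twin B `3d02100cd7d5991d`; K3-FLOW RULING F) states the scale-`0` stub at the BARE flow frame `K₀ := klFlowFrameU L M β U μ 0`
(`= 0`, `klFlowFrameU_zero`) and in the V17F slot currency (`PairLadderStepAtV17F2`, `QuarticValueUVAtV17F`, `IsoTupleL1AtV17F`, reading
ball `klBall L μ 0`), at the package `(klEngGeo6, klEngQ6 P R)` and the threshold doors `c ≤ klEngC₃6 P R`, `U ≤ klEngU₀6 P R c`
(`…EngineV8DefsU6`).  Every analytic input of the rung is ALREADY in the tree at `(G, klEngQ5 P R)`, `∀ K, FrameOK …`, thresholds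
`klEngC₃3 / klEngU₀3`, V9/V10/S-currency: (E1-v4)₀ `kernelNormsV4_zero_klEngQ5` (k3c2-p1 g2), the values conjuncts (E2)₀/(E2′ UV)₀
(`pairLadderStepAtV8_zero_of_klEng`, p3 g6), (E5-S)₀ via the isotropic torus bound (`TorusFourierL2.exists_isoTorusBoundAt`, p4 g7;
`engineScaleZero_of_isoTorusBoundAt_klIsoT`, p3 g6).  This file is the BOOKKEEPING that carries them to the flow stub's literal text:

* §1 the `n = 0` currency doors: at `K₀` the flow-currency clauses ARE the V10/S3/S clauses —
  `pairLadderStepAtV17F2_zero_iff_V10`, `pairLadderStepAtV17F_zero_iff_V10`, `quarticValueUVAtV17F_zero_iff_S3`, `isoTupleL1AtV17F_zero_iff_S`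
  (`klFlowFrameU_zero` + the void `1 ≤ 0` branches);
* §2 **`engineScaleZeroV17F2_of_firstMoments`** — for ANY well-formed `G` with `klIsoT ^ 4 ≤ G.CF`, under EXACTLY the binders of the flow stub
  (a) (doors `klEngC₃6`/`klEngU₀6`, frame hypothesis `FrameOK R U (nScales β) μ K₀`), the (E4)₀ clause
  `EngineFirstMoments L M G P (klEngQ6 P R) β U μ K₀ 0` implies the literal five-clause conclusion
  `KernelNormsV4 … (klEngQ6 P R) … K₀ 0 ∧ PairLadderStepAtV17F2 … G … 0 ∧ QuarticValueUVAtV17F … G … 0 ∧ EngineFirstMoments … G … K₀ 0 ∧ IsoTupleL1AtV17F … G … 0`;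
  **`engineScaleZeroV17F2_klEng6_of_firstMoments`** — its specialisation to `G := klEngGeo6` = stub (a) of the template MODULO (E4)₀;
  `engineScaleZeroV17F_klEng6_of_firstMoments` — the same for the rev-1 token `PairLadderStepAtV17F` (identical at `n = 0`).

`G`-parametric on purpose: a later `G`-raise of the package (e.g. for the `cE4` slot of (E4)₀) re-instantiates §2 with one `le_trans` on `CF`.
Bookkeeping only; nothing about the model is asserted beyond the cited upstream theorems; nothing asserts superconductivity.
-/

noncomputable section

namespace Summit.HubbardSuperconductivity.HubbardSuperconductivity.Theorems.EngineV8

set_option linter.dupNamespace false -- summit = problem name (single-conjunct summit), D-0017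

open Real Finset Literature.MathematicalPhysics.QuantumLattice Literature.Probability.LatticeModels
open Summit.HubbardSuperconductivity.HubbardSuperconductivity.Theorems.KLRegimeSplit
open Summit.HubbardSuperconductivity.HubbardSuperconductivity.Theorems.KLProgrammeLegKernels

/-! ## §1 The `n = 0` currency doors: flow clauses at `K₀ = klFlowFrameU … 0` versus the V10 / S3 / S clauses at `K = K₀` -/

section Doors

variable (L M : ℕ) [NeZero L] [NeZero M] (G : GeoConsts) (P : SplitConsts) (Q : EngConsts) (β U μ : ℝ)

/-- **(E2-F2)₀ is (E2-v10)₀ at the bare flow frame**: at `n = 0` the cured flow ladder clause and `PairLadderStepAtV10 … K₀ 0` coincide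
(`K₀ = 0`, so the reading balls `klBall L μ 0` / `klBall L μ K₀` agree; both `1 ≤ n` branches are void). -/
theorem pairLadderStepAtV17F2_zero_iff_V10 :
    PairLadderStepAtV17F2 L M G P Q β U μ 0 ↔ PairLadderStepAtV10 L M G P Q β U μ (klFlowFrameU L M β U μ 0) 0 := by
  simp only [PairLadderStepAtV17F2, PairLadderStepAtV10, klFlowFrameU_zero, Nat.le_zero, one_ne_zero, IsEmpty.forall_iff, and_true]

/-- **(E2-F)₀ is (E2-v10)₀ at the bare flow frame** (rev-1 token; at `n = 0` the cure does not bite). -/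
theorem pairLadderStepAtV17F_zero_iff_V10 :
    PairLadderStepAtV17F L M G P Q β U μ 0 ↔ PairLadderStepAtV10 L M G P Q β U μ (klFlowFrameU L M β U μ 0) 0 := by
  simp only [PairLadderStepAtV17F, PairLadderStepAtV10, klFlowFrameU_zero, Nat.le_zero, one_ne_zero, IsEmpty.forall_iff, and_true]

/-- At `n = 0` the rev-1 and rev-2 flow ladder clauses coincide. -/
theorem pairLadderStepAtV17F2_zero_iff_V17F :
    PairLadderStepAtV17F2 L M G P Q β U μ 0 ↔ PairLadderStepAtV17F L M G P Q β U μ 0 := by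
  rw [pairLadderStepAtV17F2_zero_iff_V10, pairLadderStepAtV17F_zero_iff_V10]

/-- **(E2′-F UV)₀ is (E2′-S3 UV)₀ at the bare flow frame.** -/
theorem quarticValueUVAtV17F_zero_iff_S3 :
    QuarticValueUVAtV17F L M G P Q β U μ 0 ↔ QuarticValueUVAtS3 L M G P Q β U μ (klFlowFrameU L M β U μ 0) 0 := by
  simp only [QuarticValueUVAtV17F, QuarticValueUVAtS3, klFlowFrameU_zero]

/-- **(E5-F)₀ is (E5-S)₀ at the bare flow frame.** -/
theorem isoTupleL1AtV17F_zero_iff_S :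
    IsoTupleL1AtV17F L M G P β U μ 0 ↔ IsoTupleL1AtS L M G P β U μ (klFlowFrameU L M β U μ 0) 0 := by
  simp only [IsoTupleL1AtV17F, IsoTupleL1AtS, klFlowFrameU_zero]

/-- **The five-clause conclusion of the flow stub (a) at `n = 0` IS the V10-currency scale-`0` conjunction at `K = K₀`.** -/
theorem scaleZeroConjV17F2_iff_V10 :
    (KernelNormsV4 L M P Q β U μ (klFlowFrameU L M β U μ 0) 0 ∧ PairLadderStepAtV17F2 L M G P Q β U μ 0 ∧
        QuarticValueUVAtV17F L M G P Q β U μ 0 ∧ EngineFirstMoments L M G P Q β U μ (klFlowFrameU L M β U μ 0) 0 ∧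
          IsoTupleL1AtV17F L M G P β U μ 0) ↔
      (KernelNormsV4 L M P Q β U μ (klFlowFrameU L M β U μ 0) 0 ∧ PairLadderStepAtV10 L M G P Q β U μ (klFlowFrameU L M β U μ 0) 0 ∧
        QuarticValueUVAtS3 L M G P Q β U μ (klFlowFrameU L M β U μ 0) 0 ∧
          EngineFirstMoments L M G P Q β U μ (klFlowFrameU L M β U μ 0) 0 ∧ IsoTupleL1AtS L M G P β U μ (klFlowFrameU L M β U μ 0) 0) := by
  rw [pairLadderStepAtV17F2_zero_iff_V10, quarticValueUVAtV17F_zero_iff_S3, isoTupleL1AtV17F_zero_iff_S]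

end Doors

/-! ## §2 The scale-`0` rung in the flow currency, modulo (E4)₀ -/

section Rung

/-- **The flow stub (a) modulo (E4)₀, `G`-parametric.**  For any well-formed `G` with `klIsoT ^ 4 ≤ G.CF`, under EXACTLY the binders of
`stub_engine_scale0` of the engine-flow template (doors `c ≤ klEngC₃6 P R`, `U ≤ klEngU₀6 P R c`; frame hypothesis at
`K₀ = klFlowFrameU L M β U μ 0`), the (E4)₀ clause at `(G, klEngQ6 P R, K₀)` implies the literal five-clause conclusion in the rev-2 flow
currency.  Proof = the landed `(G, klEngQ5)` rung `engineScaleZero_of_isoTorusBoundAt_klIsoT` at `K := K₀` (thresholds by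
`klEngC₃6_le_klEngC₃3`, `klEngU₀6_le_klEngU₀3`; torus bound `TorusFourierL2.exists_isoTorusBoundAt`), the `Q5 → Q6` raise doors
(`kernelNormsV4_klEngQ6_of_klEngQ5`, the `Iff.rfl` `raiseCE` doors), and §1. -/
theorem engineScaleZeroV17F2_of_firstMoments (G : GeoConsts) (hG : G.WF) (hCF : klIsoT ^ 4 ≤ G.CF) (P : SplitConsts) (R : RenConsts)
    (c : ℝ) (hP : P.WF) (hR : R.WF2) (hc : 0 < c) (hc₆ : c ≤ klEngC₃6 P R) (μ : ℝ) (hμ : μ ∈ klWindowC) (U : ℝ) (hU : 0 < U)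
    (hU₀ : U ≤ klEngU₀6 P R c) (β : ℝ) (hβ : klBetaMin ≤ β) (hβc : β ≤ Real.exp (c / U ^ 2)) (L M : ℕ) [NeZero L] [NeZero M]
    (hL : klEngL₃ β U ≤ L) (hM : klEngM₃ β U L ≤ M) (hK : FrameOK R U (nScales β) μ (klFlowFrameU L M β U μ 0))
    (hE4 : EngineFirstMoments L M G P (klEngQ6 P R) β U μ (klFlowFrameU L M β U μ 0) 0) :
    KernelNormsV4 L M P (klEngQ6 P R) β U μ (klFlowFrameU L M β U μ 0) 0 ∧ PairLadderStepAtV17F2 L M G P (klEngQ6 P R) β U μ 0 ∧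
      QuarticValueUVAtV17F L M G P (klEngQ6 P R) β U μ 0 ∧ EngineFirstMoments L M G P (klEngQ6 P R) β U μ (klFlowFrameU L M β U μ 0) 0 ∧
        IsoTupleL1AtV17F L M G P β U μ 0 := by
  have hc₃ : c ≤ klEngC₃3 P R := hc₆.trans (klEngC₃6_le_klEngC₃3 P R)
  have hU₃ : U ≤ klEngU₀3 P R c := hU₀.trans (klEngU₀6_le_klEngU₀3 P R c)
  -- (E4)₀ at `klEngQ5` (the clause reads `Q.cE4` only; `klEngQ6 = (klEngQ5).raiseCE …`)
  have hE4' : EngineFirstMoments L M G P (klEngQ5 P R) β U μ (klFlowFrameU L M β U μ 0) 0 :=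
    (engineFirstMoments_raiseCE_iff (klCE6 P R) (klS6' P R)).1 hE4
  obtain ⟨T, hT0, hT⟩ := TorusFourierL2.exists_isoTorusBoundAt
  obtain ⟨h1, h2, h3, -, h5⟩ := engineScaleZero_of_isoTorusBoundAt_klIsoT hT0 hT G hG hCF P R c hP hR hc hc₃ μ hμ U hU hU₃ β hβ hβc
    (klFlowFrameU L M β U μ 0) hK L M hL hM hE4'
  refine (scaleZeroConjV17F2_iff_V10 L M G P (klEngQ6 P R) β U μ).2 ⟨kernelNormsV4_klEngQ6_of_klEngQ5 hP h1, ?_, ?_, hE4, h5⟩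
  · exact (pairLadderStepAtV10_raiseCE_iff (klCE6 P R) (klS6' P R)).2
      ((pairLadderStepAtV10_iff_V9_zero G P (klEngQ5 P R) β U μ _).2 h2)
  · exact (quarticValueUVAtS3_raiseCE_iff (klCE6 P R) (klS6' P R)).2 (quarticValueUVAtS3_of_S2 h3)

/-- **Stub (a) `stub_engine_scale0` of the engine-flow template MODULO (E4)₀** — the literal five-clause conclusion at
`(klEngGeo6, klEngQ6 P R)` under exactly the stub's binders, from `EngineFirstMoments L M klEngGeo6 P (klEngQ6 P R) β U μ K₀ 0` alone
(`klIsoT ^ 4 ≤ klEngGeo6.CF` by `klIsoT_pow_four_le_klEngGeo6_CF`). -/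
theorem engineScaleZeroV17F2_klEng6_of_firstMoments (P : SplitConsts) (R : RenConsts) (c : ℝ) (hP : P.WF) (hR : R.WF2) (hc : 0 < c)
    (hc₆ : c ≤ klEngC₃6 P R) (μ : ℝ) (hμ : μ ∈ klWindowC) (U : ℝ) (hU : 0 < U) (hU₀ : U ≤ klEngU₀6 P R c) (β : ℝ)
    (hβ : klBetaMin ≤ β) (hβc : β ≤ Real.exp (c / U ^ 2)) (L M : ℕ) [NeZero L] [NeZero M] (hL : klEngL₃ β U ≤ L)
    (hM : klEngM₃ β U L ≤ M) (hK : FrameOK R U (nScales β) μ (klFlowFrameU L M β U μ 0))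
    (hE4 : EngineFirstMoments L M klEngGeo6 P (klEngQ6 P R) β U μ (klFlowFrameU L M β U μ 0) 0) :
    KernelNormsV4 L M P (klEngQ6 P R) β U μ (klFlowFrameU L M β U μ 0) 0 ∧
      PairLadderStepAtV17F2 L M klEngGeo6 P (klEngQ6 P R) β U μ 0 ∧
        QuarticValueUVAtV17F L M klEngGeo6 P (klEngQ6 P R) β U μ 0 ∧
          EngineFirstMoments L M klEngGeo6 P (klEngQ6 P R) β U μ (klFlowFrameU L M β U μ 0) 0 ∧
            IsoTupleL1AtV17F L M klEngGeo6 P β U μ 0 :=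
  engineScaleZeroV17F2_of_firstMoments klEngGeo6 klEngGeo6_wf klIsoT_pow_four_le_klEngGeo6_CF P R c hP hR hc hc₆ μ hμ U hU hU₀ β hβ
    hβc L M hL hM hK hE4

/-- The same in the rev-1 token `PairLadderStepAtV17F` (template twin B before the S3′ re-key; identical clause at `n = 0`). -/
theorem engineScaleZeroV17F_klEng6_of_firstMoments (P : SplitConsts) (R : RenConsts) (c : ℝ) (hP : P.WF) (hR : R.WF2) (hc : 0 < c)
    (hc₆ : c ≤ klEngC₃6 P R) (μ : ℝ) (hμ : μ ∈ klWindowC) (U : ℝ) (hU : 0 < U) (hU₀ : U ≤ klEngU₀6 P R c) (β : ℝ)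
    (hβ : klBetaMin ≤ β) (hβc : β ≤ Real.exp (c / U ^ 2)) (L M : ℕ) [NeZero L] [NeZero M] (hL : klEngL₃ β U ≤ L)
    (hM : klEngM₃ β U L ≤ M) (hK : FrameOK R U (nScales β) μ (klFlowFrameU L M β U μ 0))
    (hE4 : EngineFirstMoments L M klEngGeo6 P (klEngQ6 P R) β U μ (klFlowFrameU L M β U μ 0) 0) :
    KernelNormsV4 L M P (klEngQ6 P R) β U μ (klFlowFrameU L M β U μ 0) 0 ∧
      PairLadderStepAtV17F L M klEngGeo6 P (klEngQ6 P R) β U μ 0 ∧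
        QuarticValueUVAtV17F L M klEngGeo6 P (klEngQ6 P R) β U μ 0 ∧
          EngineFirstMoments L M klEngGeo6 P (klEngQ6 P R) β U μ (klFlowFrameU L M β U μ 0) 0 ∧
            IsoTupleL1AtV17F L M klEngGeo6 P β U μ 0 := by
  obtain ⟨h1, h2, h3, h4, h5⟩ := engineScaleZeroV17F2_klEng6_of_firstMoments P R c hP hR hc hc₆ μ hμ U hU hU₀ β hβ hβc L M hL hM hK hE4
  exact ⟨h1, (pairLadderStepAtV17F2_zero_iff_V17F L M klEngGeo6 P (klEngQ6 P R) β U μ).1 h2, h3, h4, h5⟩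

/-- **The four (E4)-free conjuncts of the flow stub (a), UNCONDITIONALLY** under its binders, `G`-parametric: (E1-v4)₀ at `klEngQ6`,
(E2-F2)₀, (E2′-F UV)₀ and (E5-F)₀ — what the tree closes today for the scale-`0` rung of the engine-flow child, by name. -/
theorem engineScaleZeroV17F2_noE4 (G : GeoConsts) (hG : G.WF) (hCF : klIsoT ^ 4 ≤ G.CF) (P : SplitConsts) (R : RenConsts)
    (c : ℝ) (hP : P.WF) (hR : R.WF2) (hc : 0 < c) (hc₆ : c ≤ klEngC₃6 P R) (μ : ℝ) (hμ : μ ∈ klWindowC) (U : ℝ) (hU : 0 < U)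
    (hU₀ : U ≤ klEngU₀6 P R c) (β : ℝ) (hβ : klBetaMin ≤ β) (hβc : β ≤ Real.exp (c / U ^ 2)) (L M : ℕ) [NeZero L] [NeZero M]
    (hL : klEngL₃ β U ≤ L) (hM : klEngM₃ β U L ≤ M) (hK : FrameOK R U (nScales β) μ (klFlowFrameU L M β U μ 0)) :
    KernelNormsV4 L M P (klEngQ6 P R) β U μ (klFlowFrameU L M β U μ 0) 0 ∧ PairLadderStepAtV17F2 L M G P (klEngQ6 P R) β U μ 0 ∧
      QuarticValueUVAtV17F L M G P (klEngQ6 P R) β U μ 0 ∧ IsoTupleL1AtV17F L M G P β U μ 0 := by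
  have hc₃ : c ≤ klEngC₃3 P R := hc₆.trans (klEngC₃6_le_klEngC₃3 P R)
  have hU₃ : U ≤ klEngU₀3 P R c := hU₀.trans (klEngU₀6_le_klEngU₀3 P R c)
  obtain ⟨T, hT0, hT⟩ := TorusFourierL2.exists_isoTorusBoundAt
  -- (E1-v4)₀ at `klEngQ5`, then raised
  have h1 : KernelNormsV4 L M P (klEngQ5 P R) β U μ (klFlowFrameU L M β U μ 0) 0 :=
    kernelNormsV4_zero_klEngQ5 P R c hP hR hc hc₃ μ hμ U hU hU₃ β hβ hβc (klFlowFrameU L M β U μ 0) hK L M hL hM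
  -- the values conjuncts at `(G, klEngQ5)`, V8/V9 currency at `n = 0`
  obtain ⟨hE2, hUV⟩ := pairLadderStepAtV8_zero_of_klEng (L := L) (M := M) (G := G) (Q := klEngQ5 P R) hG hP (klEngQ5_wf P R)
    hR.wf hU (le_one_of_le_klEngU₀3 hU₃) hβ hK hL hM (klScaleZeroThetaC_mul_le_half_of_le_klEngU₀3 hR.wf hU hU₃)
    (klScaleZeroValC_le_four_mul_klEngQ5_CR hP.1 R)
  -- (E5-S)₀ at `G`
  have h5 : IsoTupleL1AtS L M G P β U μ (klFlowFrameU L M β U μ 0) 0 :=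
    isoTupleL1AtS_zero_of_isoTorusBoundAt klIsoT_nonneg (isoTorusBoundAt_klIsoT hT0 hT) P R c hP hR hc hc₃ μ hμ U hU hU₃ β hβ hβc
      (klFlowFrameU L M β U μ 0) hK L M hL hM hCF
  refine ⟨kernelNormsV4_klEngQ6_of_klEngQ5 hP h1, ?_, ?_, (isoTupleL1AtV17F_zero_iff_S L M G P β U μ).2 h5⟩
  · rw [pairLadderStepAtV17F2_zero_iff_V10]
    exact (pairLadderStepAtV10_raiseCE_iff (klCE6 P R) (klS6' P R)).2
      ((pairLadderStepAtV10_iff_V9_zero G P (klEngQ5 P R) β U μ _).2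
        ((pairLadderStepAtV9_iff_V8_zero G P (klEngQ5 P R) β U μ _).2 hE2))
  · rw [quarticValueUVAtV17F_zero_iff_S3]
    exact (quarticValueUVAtS3_raiseCE_iff (klCE6 P R) (klS6' P R)).2 (quarticValueUVAtS3_of_S2 hUV)

end Rung

end Summit.HubbardSuperconductivity.HubbardSuperconductivity.Theorems.EngineV8

end
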